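import Mathlib
import HarnessLib.Audit
import Summits.PneNP.PneNP.Theorems.PstarLiteralPinning

/-!
# The square of a dirty member: frozen-or-thawed gate partners kill the certificate (ROUND-24, O1; memo g27 §72)

FRONTIER range-avoidance ladder, rung F-N3, ROUND 24 (cell `pnp-ideate`, prover-2 memo `g27/O1-PINNING-g27.md` §72; census node
`PstarLocalGateBudgetAssembly.LocalMenuCriterionBoundGateBudget`; restricted-model proof complexity — nothing here bears on `P` versus `NP`).

Toward the (A)-side BLOCK RULE (p3 memo r24 §14.63: «three-block arcs certify nothing»).  Let `(K; Γ₁, Γ₂)` be a candidate certificate and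
`e ∈ K` a DIRTY member: both its AND variables `p, p'` are private (in no other output of `K`, in no monomial or read of `Γ₁`, no XOR variable
of `e`), and no monomial of `Γ₂` duplicates the pair `{p, p'}` (simple overlaps).  Write `Ā = Sol(K ∖ e) ∩ {Γ₁ = b₁}` (`InSliceBut`),
`A = Ā ∩ Sol(e)` (`PstarLiteralPinning.InSlice`) and `A₀ = A ∩ {x_p x_{p'} = 0}`.

* `bit_gval_square` — through every `q ∈ Ā` runs the SQUARE `q^{ab}` (`(x_p, x_{p'}) := (a, b)`) inside `Ā`, on which `Γ₂` is AFFINE: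
  `Γ₂(q^{ab}) = Γ₂(q^{00}) + a·L_p + b·L_{p'}` with the slopes `L_v = [v ∈ C₂] + starSum_{G₂}(v)` (no `ab` term: no gate `{p, p'}`);
* `slopes_zero_of_idle` — (T3) at a point of `A₀`: three corners of its square lie in `A`, so both slopes vanish there;
* **`no_thawed_partner`** — hence a `Γ₂`-gate partner `u` of `p` (or `p'`) is never THAWED in `A₀` (no `z` with `z, z ⊕ e_u ∈ A₀`): flipping `u`
  moves `L_p` by exactly one;
* **`gval_ne_on_sliceBut`** — if every gate partner of `p, p'` is FROZEN on `Ā` (one value throughout `Ā`) or thawed in `A₀`, and `A₀ ≠ ∅`, then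
  `Γ₂ ≠ b₂` on ALL of `Ā`: (M0) fails at `e`, **`not_terminal_of_dirty_member`**;
* **`not_terminal_of_untouched_dirty`** — in particular `Γ₂` must TOUCH every dirty member that can be switched off inside the slice (some monomial
  through `p` or `p'`): p3's «the second reader sees every defect».

USE (all `k`, with `PstarLiteralPinning`): on a cycle core, a dirty chord `d` in an arc carrying ≥ 2 FURTHER blocks satisfies the hypotheses for
every second reader — `A₀ ≠ ∅` and «partner thawed in `A₀` unless pinned» are pattern-feasibility statements (no value-one join inside the dead
terms), and pinned literals are frozen on `Ā` (their joins avoid `d`).  So such arcs certify nothing: the dirty half of the three-block rule.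
-/

set_option linter.dupNamespace false -- `Summit.PneNP.PneNP.…`: summit = sub-problem name (D-0017 single-conjunct layout)

open Finset Literature.Computability.Complexity
open Summit.PneNP.PneNP.Theorems.PstarFibrePolys (bit bit_xor bit_and bit_injective)
open Summit.PneNP.PneNP.Theorems.PstarSALevel (varSet)
open Summit.PneNP.PneNP.Theorems.PstarGapPeeling (eval_pure eval_update_of_not_mem)
open Summit.PneNP.PneNP.Theorems.PstarGapOneAll (gval)
open Summit.PneNP.PneNP.Theorems.PstarGConstraint (bit_gval gval_update_of_forall_ne)
open Summit.PneNP.PneNP.Theorems.PstarCoreBoundTargets (Terminal)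
open Summit.PneNP.PneNP.Theorems.PstarMenuLocality (starSum bit_gval_update starSum_update_partner)
open Summit.PneNP.PneNP.Theorems.PstarLiteralPinning (InSlice)

namespace Summit.PneNP.PneNP.Theorems.PstarDirtyMemberSquare

variable {n m : ℕ}

/-- The BIG slice `Ā = Sol(K ∖ e) ∩ {Γ₁ = b₁}`: every output of `K` other than `e` solved, the first reader on target. -/
def InSliceBut (I : LocalMap 4 n m) (y : Fin m → Bool) (K : Finset (Fin m)) (e : Fin m) (w₁ : Finset (Fin n) × Finset (Fin m) × Bool)
    (z : Fin n → Bool) : Prop :=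
  (∀ j ∈ K, j ≠ e → I.eval z j = y j) ∧ gval I w₁.1 w₁.2.1 z = w₁.2.2

variable {I : LocalMap 4 n m} {y : Fin m → Bool} {K : Finset (Fin m)} {w₁ w₂ : Finset (Fin n) × Finset (Fin m) × Bool} {e : Fin m}
  {p p' : Fin n}

/-- `A = Ā ∩ Sol(e)`. -/
theorem inSlice_iff (he : e ∈ K) {z : Fin n → Bool} : InSlice I y K w₁ z ↔ InSliceBut I y K e w₁ z ∧ I.eval z e = y e :=
  ⟨fun h => ⟨⟨fun j hj _ => h.1 j hj, h.2⟩, h.1 e he⟩, fun h => ⟨fun j hj => by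
    by_cases hje : j = e
    · rw [hje]; exact h.2
    · exact h.1.1 j hj hje, h.1.2⟩⟩

/-! ## The square of a dirty member -/
section Square

/-- The partner sum of `v` does not see a variable `w` that is never paired with `v`. -/
theorem starSum_update_of_unpaired (G : Finset (Fin m)) {v w : Fin n} (z : Fin n → Bool) (b : Bool)
    (h : ∀ g ∈ G, (I.vars g 2 = v → I.vars g 3 ≠ w) ∧ (I.vars g 3 = v → I.vars g 2 ≠ w)) :
    starSum I G v (Function.update z w b) = starSum I G v z := by
  unfold PstarMenuLocality.starSum
  refine sum_congr rfl fun g hg => ?_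
  by_cases h2 : I.vars g 2 = v
  · rw [if_pos h2, if_pos h2, Function.update_of_ne ((h g hg).1 h2)]
    by_cases h3 : I.vars g 3 = v
    · rw [if_pos h3, if_pos h3, Function.update_of_ne ((h g hg).2 h3)]
    · rw [if_neg h3, if_neg h3]
  · rw [if_neg h2, if_neg h2]
    by_cases h3 : I.vars g 3 = v
    · rw [if_pos h3, if_pos h3, Function.update_of_ne ((h g hg).2 h3)]
    · rw [if_neg h3, if_neg h3]

/-- `p ≠ p'` for the two AND slots of `e`. -/
theorem ne_of_slots (hI : I.IsPure xorAndPred) (hslots : I.vars e 2 = p ∧ I.vars e 3 = p') : p ≠ p' := by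
  rw [← hslots.1, ← hslots.2]; exact fun h => absurd (hI.2 e h) (by decide)

variable (hI : I.IsPure xorAndPred) (hslots : I.vars e 2 = p ∧ I.vars e 3 = p')
  (hpp' : ∀ g ∈ w₂.2.1, ¬ ((I.vars g 2 = p ∧ I.vars g 3 = p') ∨ (I.vars g 2 = p' ∧ I.vars g 3 = p)))
include hI hslots hpp'

/-- The slope `L_p = [p ∈ C₂] + starSum(p)` does not see `x_p, x_{p'}`. -/
theorem slope_update (z : Fin n → Bool) {w : Fin n} (hw : w = p ∨ w = p') (b : Bool) :
    starSum I w₂.2.1 p (Function.update z w b) = starSum I w₂.2.1 p z := by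
  refine starSum_update_of_unpaired _ z b fun g hg => ⟨fun h2 h3 => ?_, fun h3 h2 => ?_⟩
  · rcases hw with rfl | rfl
    · exact absurd (h2.trans h3.symm) fun h => absurd (hI.2 g h) (by decide)
    · exact hpp' g hg (Or.inl ⟨h2, h3⟩)
  · rcases hw with rfl | rfl
    · exact absurd (h3.trans h2.symm) fun h => absurd (hI.2 g h.symm) (by decide)
    · exact hpp' g hg (Or.inr ⟨h2, h3⟩)

/-- The same for `L_{p'}`. -/
theorem slope_update' (z : Fin n → Bool) {w : Fin n} (hw : w = p ∨ w = p') (b : Bool) :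
    starSum I w₂.2.1 p' (Function.update z w b) = starSum I w₂.2.1 p' z := by
  refine starSum_update_of_unpaired _ z b fun g hg => ⟨fun h2 h3 => ?_, fun h3 h2 => ?_⟩
  · rcases hw with rfl | rfl
    · exact hpp' g hg (Or.inr ⟨h2, h3⟩)
    · exact absurd (h2.trans h3.symm) fun h => absurd (hI.2 g h) (by decide)
  · rcases hw with rfl | rfl
    · exact hpp' g hg (Or.inl ⟨h2, h3⟩)
    · exact absurd (h3.trans h2.symm) fun h => absurd (hI.2 g h.symm) (by decide)

/-- **`Γ₂` IS AFFINE ON THE SQUARE**: `Γ₂(q[p := a][p' := b]) = Γ₂(q[p := 0][p' := 0]) + a·L_p(q) + b·L_{p'}(q)`. -/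
theorem bit_gval_square (q : Fin n → Bool) (a b : Bool) :
    bit (gval I w₂.1 w₂.2.1 (Function.update (Function.update q p a) p' b)) =
      bit (gval I w₂.1 w₂.2.1 (Function.update (Function.update q p false) p' false)) +
        bit a * ((if p ∈ w₂.1 then 1 else 0) + starSum I w₂.2.1 p q) + bit b * ((if p' ∈ w₂.1 then 1 else 0) + starSum I w₂.2.1 p' q) := by
  have hne := ne_of_slots hI hslots
  -- both corners from the common point `q[p := a][p' := 0]`… go through `q₀₀`
  set q₀ := Function.update (Function.update q p false) p' false with hq₀
  have e1 : Function.update (Function.update q p a) p' b = Function.update (Function.update q₀ p a) p' b := by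
    ext w
    by_cases hw' : w = p'
    · subst hw'; simp
    · by_cases hw : w = p
      · subst hw; simp [hw']
      · simp [hq₀, Function.update_of_ne hw, Function.update_of_ne hw']
  rw [e1, bit_gval_update I hI, bit_gval_update I hI]
  have hq₀p : q₀ p = false := by rw [hq₀, Function.update_of_ne hne, Function.update_self]
  have hq₀ap' : Function.update q₀ p a p' = false := by rw [Function.update_of_ne hne.symm, hq₀, Function.update_self]
  rw [hq₀p, hq₀ap', slope_update' hI hslots hpp' q₀ (Or.inl rfl)]
  have hs : starSum I w₂.2.1 p q₀ = starSum I w₂.2.1 p q := by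
    rw [hq₀, slope_update hI hslots hpp' _ (Or.inr rfl), slope_update hI hslots hpp' _ (Or.inl rfl)]
  have hs' : starSum I w₂.2.1 p' q₀ = starSum I w₂.2.1 p' q := by
    rw [hq₀, slope_update' hI hslots hpp' _ (Or.inr rfl), slope_update' hI hslots hpp' _ (Or.inl rfl)]
  rw [hs, hs']
  simp only [bit, Bool.false_eq_true, if_false, add_zero]

end Square

/-! ## The slopes vanish at idle points, partners are never thawed, and `Γ₂` is constant on `Ā` -/
section Main

/-- The square stays in `Ā` (privacy of `p, p'` on the `Γ₁`-side). -/
theorem inSliceBut_update (hpK : ∀ j ∈ K, j ≠ e → p ∉ varSet I j ∧ p' ∉ varSet I j) (hpC₁ : p ∉ w₁.1 ∧ p' ∉ w₁.1)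
    (hpG₁ : ∀ g ∈ w₁.2.1, (I.vars g 2 ≠ p ∧ I.vars g 3 ≠ p) ∧ (I.vars g 2 ≠ p' ∧ I.vars g 3 ≠ p'))
    {q : Fin n → Bool} (hq : InSliceBut I y K e w₁ q) {w : Fin n} (hw : w = p ∨ w = p') (b : Bool) :
    InSliceBut I y K e w₁ (Function.update q w b) := by
  refine ⟨fun j hj hje => ?_, ?_⟩
  · rw [eval_update_of_not_mem I j q (by rcases hw with rfl | rfl; exacts [(hpK j hj hje).1, (hpK j hj hje).2]) b]
    exact hq.1 j hj hje
  · rcases hw with rfl | rfl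
    · rw [gval_update_of_forall_ne I q hpC₁.1 fun g hg => (hpG₁ g hg).1]; exact hq.2
    · rw [gval_update_of_forall_ne I q hpC₁.2 fun g hg => (hpG₁ g hg).2]; exact hq.2

/-- The value of `e` on the square: XOR part of `q` plus `a ∧ b`. -/
theorem eval_square (hI : I.IsPure xorAndPred) (hslots : I.vars e 2 = p ∧ I.vars e 3 = p')
    (hpe : I.vars e 0 ≠ p ∧ I.vars e 1 ≠ p ∧ I.vars e 0 ≠ p' ∧ I.vars e 1 ≠ p') (q : Fin n → Bool) (a b : Bool) :
    I.eval (Function.update (Function.update q p a) p' b) e = xor (xor (q (I.vars e 0)) (q (I.vars e 1))) (a && b) := by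
  have hne : p ≠ p' := ne_of_slots hI hslots
  rw [eval_pure I hI, hslots.1, hslots.2]
  simp [Function.update_of_ne hpe.1, Function.update_of_ne hpe.2.1, Function.update_of_ne hpe.2.2.1,
    Function.update_of_ne hpe.2.2.2, Function.update_of_ne hne]

variable (hI : I.IsPure xorAndPred) (he : e ∈ K) (hslots : I.vars e 2 = p ∧ I.vars e 3 = p')
  (hpe : I.vars e 0 ≠ p ∧ I.vars e 1 ≠ p ∧ I.vars e 0 ≠ p' ∧ I.vars e 1 ≠ p')
  (hpK : ∀ j ∈ K, j ≠ e → p ∉ varSet I j ∧ p' ∉ varSet I j) (hpC₁ : p ∉ w₁.1 ∧ p' ∉ w₁.1)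
  (hpG₁ : ∀ g ∈ w₁.2.1, (I.vars g 2 ≠ p ∧ I.vars g 3 ≠ p) ∧ (I.vars g 2 ≠ p' ∧ I.vars g 3 ≠ p'))
  (hpp' : ∀ g ∈ w₂.2.1, ¬ ((I.vars g 2 = p ∧ I.vars g 3 = p') ∨ (I.vars g 2 = p' ∧ I.vars g 3 = p)))
include hI he hslots hpe hpK hpC₁ hpG₁ hpp'

/-- **SLOPES VANISH AT IDLE POINTS.**  (T3) for `Γ₂` on `A`; `z ∈ A` with `x_p x_{p'} = 0`: then `L_p(z) = L_{p'}(z) = 0`. -/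
theorem slopes_zero_of_idle (hT3 : ∀ z, InSlice I y K w₁ z → gval I w₂.1 w₂.2.1 z ≠ w₂.2.2) {z : Fin n → Bool} (hz : InSlice I y K w₁ z)
    (hidle : (z p && z p') = false) :
    (if p ∈ w₂.1 then (1 : ZMod 2) else 0) + starSum I w₂.2.1 p z = 0 ∧
      (if p' ∈ w₂.1 then (1 : ZMod 2) else 0) + starSum I w₂.2.1 p' z = 0 := by
  have hzb := (inSlice_iff he).1 hz
  -- the three idle corners are in `A`
  have hcorner : ∀ a b : Bool, (a && b) = false → InSlice I y K w₁ (Function.update (Function.update z p a) p' b) := by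
    intro a b hab
    refine (inSlice_iff he).2 ⟨inSliceBut_update hpK hpC₁ hpG₁
      (inSliceBut_update hpK hpC₁ hpG₁ hzb.1 (Or.inl rfl) a) (Or.inr rfl) b, ?_⟩
    rw [eval_square hI hslots hpe, hab, ← hidle]
    have := hzb.2
    rw [eval_pure I hI, hslots.1, hslots.2] at this
    exact this
  have hκ : ∀ a b : Bool, (a && b) = false →
      gval I w₂.1 w₂.2.1 (Function.update (Function.update z p a) p' b) = !w₂.2.2 := by
    intro a b hab
    have h := hT3 _ (hcorner a b hab)
    revert h; cases gval I w₂.1 w₂.2.1 _ <;> cases w₂.2.2 <;> decide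
  have h10 := bit_gval_square hI hslots hpp' z true false
  have h01 := bit_gval_square hI hslots hpp' z false true
  rw [hκ false false rfl] at h10 h01
  rw [hκ true false rfl] at h10
  rw [hκ false true rfl] at h01
  simp only [bit, if_true, Bool.false_eq_true, if_false, one_mul, zero_mul, add_zero] at h10 h01
  constructor
  · linear_combination -h10
  · linear_combination -h01

/-- **NO THAWED PARTNER.**  (T3) on `A`; `g ∈ G₂` pairs `v ∈ {p, p'}` with `u ∉ {p, p'}` (the only such monomial, simple overlaps).  Then `u` is not
thawed in `A₀`: there is no `z` with `z ∈ A₀` and `z ⊕ e_u ∈ A₀`. -/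
theorem no_thawed_partner (hT3 : ∀ z, InSlice I y K w₁ z → gval I w₂.1 w₂.2.1 z ≠ w₂.2.2) {g : Fin m} (hg : g ∈ w₂.2.1) {u v : Fin n}
    (hv : v = p ∨ v = p') (hgs : (I.vars g 2 = v ∧ I.vars g 3 = u) ∨ (I.vars g 2 = u ∧ I.vars g 3 = v))
    (huniq : ∀ g' ∈ w₂.2.1, g' ≠ g → ¬ ((I.vars g' 2 = v ∧ I.vars g' 3 = u) ∨ (I.vars g' 2 = u ∧ I.vars g' 3 = v)))
    (hup : u ≠ p) (hup' : u ≠ p') {z : Fin n → Bool} (hz : InSlice I y K w₁ z) (hidle : (z p && z p') = false)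
    (hz' : InSlice I y K w₁ (Function.update z u (!z u))) : False := by
  have hidle' : (Function.update z u (!z u) p && Function.update z u (!z u) p') = false := by
    rw [Function.update_of_ne hup.symm, Function.update_of_ne hup'.symm]; exact hidle
  have h0 := slopes_zero_of_idle hI he hslots hpe hpK hpC₁ hpG₁ hpp' hT3 hz hidle
  have h1 := slopes_zero_of_idle hI he hslots hpe hpK hpC₁ hpG₁ hpp' hT3 hz' hidle'
  have hmove := starSum_update_partner I hI hg hgs huniq z (!z u)
  have hba : bit (!z u) + bit (z u) = 1 := by cases z u <;> decide
  rw [hba] at hmove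
  rcases hv with rfl | rfl
  · have := h1.1; rw [hmove] at this
    have h2 : (1 : ZMod 2) = 0 := by linear_combination this - h0.1
    exact absurd h2 (by decide)
  · have := h1.2; rw [hmove] at this
    have h2 : (1 : ZMod 2) = 0 := by linear_combination this - h0.2
    exact absurd h2 (by decide)

/-- **`Γ₂` MISSES `b₂` ON ALL OF `Ā`.**  (T3) on `A`; simple overlaps among the monomials of `Γ₂`; `A₀ ≠ ∅`; and every `Γ₂`-gate partner `u` of
`p` or `p'` is FROZEN on `Ā` or THAWED in `A₀`.  Then `Γ₂ ≠ b₂` at every point of `Ā = Sol(K ∖ e) ∩ {Γ₁ = b₁}` — (M0) fails at `e`. -/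
theorem gval_ne_on_sliceBut (hT3 : ∀ z, InSlice I y K w₁ z → gval I w₂.1 w₂.2.1 z ≠ w₂.2.2)
    (hSG : ∀ g ∈ w₂.2.1, ∀ g' ∈ w₂.2.1, g' ≠ g → ¬ ((I.vars g' 2 = I.vars g 2 ∧ I.vars g' 3 = I.vars g 3) ∨
      (I.vars g' 2 = I.vars g 3 ∧ I.vars g' 3 = I.vars g 2)))
    (hA₀ : ∃ z, InSlice I y K w₁ z ∧ (z p && z p') = false)
    (hthaw : ∀ g ∈ w₂.2.1, ∀ u v : Fin n, (v = p ∨ v = p') → ((I.vars g 2 = v ∧ I.vars g 3 = u) ∨ (I.vars g 2 = u ∧ I.vars g 3 = v)) →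
      (∀ q q' : Fin n → Bool, InSliceBut I y K e w₁ q → InSliceBut I y K e w₁ q' → q u = q' u) ∨
      (∃ z, (InSlice I y K w₁ z ∧ (z p && z p') = false) ∧ InSlice I y K w₁ (Function.update z u (!z u))))
    {q : Fin n → Bool} (hq : InSliceBut I y K e w₁ q) : gval I w₂.1 w₂.2.1 q ≠ w₂.2.2 := by
  have hne : p ≠ p' := by rw [← hslots.1, ← hslots.2]; exact fun h => absurd (hI.2 e h) (by decide)
  obtain ⟨z₀, hz₀, hidle₀⟩ := hA₀
  have hz₀b := ((inSlice_iff he).1 hz₀).1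
  -- every partner is frozen on `Ā`
  have hfrozen : ∀ g ∈ w₂.2.1, ∀ u v : Fin n, (v = p ∨ v = p') → ((I.vars g 2 = v ∧ I.vars g 3 = u) ∨ (I.vars g 2 = u ∧ I.vars g 3 = v)) →
      q u = z₀ u := by
    intro g hg u v hv hgs
    have hup : u ≠ p := by
      rintro rfl
      rcases hv with rfl | rfl
      · rcases hgs with ⟨h2, h3⟩ | ⟨h2, h3⟩ <;> exact absurd (h2.trans h3.symm) fun h => absurd (hI.2 g h) (by decide)
      · exact hpp' g hg (hgs.elim (fun h => Or.inr h) fun h => Or.inl h)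
    have hup' : u ≠ p' := by
      rintro rfl
      rcases hv with rfl | rfl
      · exact hpp' g hg hgs
      · rcases hgs with ⟨h2, h3⟩ | ⟨h2, h3⟩ <;> exact absurd (h2.trans h3.symm) fun h => absurd (hI.2 g h) (by decide)
    rcases hthaw g hg u v hv hgs with hfr | ⟨z, ⟨hz, hidle⟩, hz'⟩
    · exact hfr q z₀ hq hz₀b
    · have huniq : ∀ g' ∈ w₂.2.1, g' ≠ g → ¬ ((I.vars g' 2 = v ∧ I.vars g' 3 = u) ∨ (I.vars g' 2 = u ∧ I.vars g' 3 = v)) := by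
        intro g' hg' hne' h
        apply hSG g hg g' hg' hne'
        rcases hgs with ⟨h2, h3⟩ | ⟨h2, h3⟩ <;> rcases h with ⟨h2', h3'⟩ | ⟨h2', h3'⟩
        · exact Or.inl ⟨h2'.trans h2.symm, h3'.trans h3.symm⟩
        · exact Or.inr ⟨h2'.trans h3.symm, h3'.trans h2.symm⟩
        · exact Or.inr ⟨h2'.trans h3.symm, h3'.trans h2.symm⟩
        · exact Or.inl ⟨h2'.trans h2.symm, h3'.trans h3.symm⟩
      exact (no_thawed_partner hI he hslots hpe hpK hpC₁ hpG₁ hpp' hT3 hg hv hgs huniq hup hup' hz hidle hz').elim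
  -- hence both slopes at `q` equal the slopes at `z₀`, which vanish
  have hstar : ∀ v, (v = p ∨ v = p') → starSum I w₂.2.1 v q = starSum I w₂.2.1 v z₀ := by
    intro v hv
    unfold PstarMenuLocality.starSum
    refine sum_congr rfl fun g hg => ?_
    by_cases h2 : I.vars g 2 = v
    · have h3 : I.vars g 3 ≠ v := fun h => absurd (h2.trans h.symm) fun h' => absurd (hI.2 g h') (by decide)
      rw [if_pos h2, if_pos h2, if_neg h3, if_neg h3, hfrozen g hg (I.vars g 3) v hv (Or.inl ⟨h2, rfl⟩)]
    · by_cases h3 : I.vars g 3 = v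
      · rw [if_neg h2, if_neg h2, if_pos h3, if_pos h3, hfrozen g hg (I.vars g 2) v hv (Or.inr ⟨rfl, h3⟩)]
      · rw [if_neg h2, if_neg h2, if_neg h3, if_neg h3]
  have h0 := slopes_zero_of_idle hI he hslots hpe hpK hpC₁ hpG₁ hpp' hT3 hz₀ hidle₀
  rw [← hstar p (Or.inl rfl), ← hstar p' (Or.inr rfl)] at h0
  -- the corner of the square through `q` that solves `e`
  set t := xor (xor (q (I.vars e 0)) (q (I.vars e 1))) (y e) with ht
  have hcorner : InSlice I y K w₁ (Function.update (Function.update q p t) p' t) := by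
    refine (inSlice_iff he).2 ⟨inSliceBut_update hpK hpC₁ hpG₁
      (inSliceBut_update hpK hpC₁ hpG₁ hq (Or.inl rfl) t) (Or.inr rfl) t, ?_⟩
    rw [eval_square hI hslots hpe, Bool.and_self, ht]
    cases q (I.vars e 0) <;> cases q (I.vars e 1) <;> cases y e <;> rfl
  have hκ := hT3 _ hcorner
  -- `Γ₂` is constant on the square
  have hsq := bit_gval_square hI hslots hpp' q t t
  have hsq' := bit_gval_square hI hslots hpp' q (q p) (q p')
  simp only [h0.1, h0.2, mul_zero, add_zero] at hsq hsq'
  have hqq : Function.update (Function.update q p (q p)) p' (q p') = q := by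
    ext w
    by_cases hw' : w = p'
    · subst hw'; simp
    · by_cases hw : w = p
      · subst hw; simp [Function.update_of_ne hne]
      · rw [Function.update_of_ne hw', Function.update_of_ne hw]
  rw [hqq] at hsq'
  rw [← bit_injective (hsq'.trans hsq.symm)] at hκ
  exact hκ

/-- **A DIRTY MEMBER WITH FROZEN-OR-THAWED GATE PARTNERS KILLS THE CERTIFICATE**: under the hypotheses of `gval_ne_on_sliceBut` the pair
`(K; Γ₁, Γ₂)` is not terminal ((M0) at `e` would need a point of `Ā` with `Γ₂ = b₂`). -/
theorem not_terminal_of_dirty_member {r : ℕ}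
    (hSG : ∀ g ∈ w₂.2.1, ∀ g' ∈ w₂.2.1, g' ≠ g → ¬ ((I.vars g' 2 = I.vars g 2 ∧ I.vars g' 3 = I.vars g 3) ∨
      (I.vars g' 2 = I.vars g 3 ∧ I.vars g' 3 = I.vars g 2)))
    (hA₀ : ∃ z, InSlice I y K w₁ z ∧ (z p && z p') = false)
    (hthaw : ∀ g ∈ w₂.2.1, ∀ u v : Fin n, (v = p ∨ v = p') → ((I.vars g 2 = v ∧ I.vars g 3 = u) ∨ (I.vars g 2 = u ∧ I.vars g 3 = v)) →
      (∀ q q' : Fin n → Bool, InSliceBut I y K e w₁ q → InSliceBut I y K e w₁ q' → q u = q' u) ∨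
      (∃ z, (InSlice I y K w₁ z ∧ (z p && z p') = false) ∧ InSlice I y K w₁ (Function.update z u (!z u)))) :
    ¬ Terminal I r y K w₁ w₂ := by
  intro ht
  obtain ⟨-, -, -, -, -, -, hT3, hM0⟩ := ht
  have hT3' : ∀ z, InSlice I y K w₁ z → gval I w₂.1 w₂.2.1 z ≠ w₂.2.2 := fun z hz h => hT3 ⟨z, hz.1, hz.2, h⟩
  obtain ⟨q, hqK, hq₁, hq₂⟩ := hM0 e he
  exact gval_ne_on_sliceBut hI he hslots hpe hpK hpC₁ hpG₁ hpp' hT3' hSG hA₀ hthaw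
    ⟨fun j hj hje => hqK j (mem_erase.2 ⟨hje, hj⟩), hq₁⟩ hq₂

/-- **`Γ₂` MUST TOUCH EVERY IDLE-ABLE DIRTY MEMBER** (p3's «the second reader sees every defect»): if no monomial of `Γ₂` passes through `p` or
`p'` and `A₀ ≠ ∅` (the member can be switched off inside the slice), the pair is not terminal — no freeze/thaw hypothesis, no simple overlaps. -/
theorem not_terminal_of_untouched_dirty {r : ℕ} (huntouched : ∀ g ∈ w₂.2.1, ¬ PstarLiteralPinning.Through I p g ∧ ¬ PstarLiteralPinning.Through I p' g)
    (hA₀ : ∃ z, InSlice I y K w₁ z ∧ (z p && z p') = false) : ¬ Terminal I r y K w₁ w₂ := by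
  intro ht
  obtain ⟨-, -, -, -, -, -, hT3, hM0⟩ := ht
  have hT3' : ∀ z, InSlice I y K w₁ z → gval I w₂.1 w₂.2.1 z ≠ w₂.2.2 := fun z hz h => hT3 ⟨z, hz.1, hz.2, h⟩
  have hne : p ≠ p' := ne_of_slots hI hslots
  obtain ⟨q, hqK, hq₁, hq₂⟩ := hM0 e he
  have hq : InSliceBut I y K e w₁ q := ⟨fun j hj hje => hqK j (mem_erase.2 ⟨hje, hj⟩), hq₁⟩
  -- both partner sums vanish identically; the constant parts vanish at an idle point
  have hstar0 : ∀ v, (v = p ∨ v = p') → ∀ zz : Fin n → Bool, starSum I w₂.2.1 v zz = 0 := by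
    intro v hv zz
    unfold PstarMenuLocality.starSum
    refine sum_eq_zero fun g hg => ?_
    have hng : ¬ PstarLiteralPinning.Through I v g := by rcases hv with rfl | rfl; exacts [(huntouched g hg).1, (huntouched g hg).2]
    rw [if_neg (fun h => hng (Or.inl h)), if_neg (fun h => hng (Or.inr h)), add_zero]
  obtain ⟨z₀, hz₀, hidle₀⟩ := hA₀
  have h0 := slopes_zero_of_idle hI he hslots hpe hpK hpC₁ hpG₁ hpp' hT3' hz₀ hidle₀
  rw [hstar0 p (Or.inl rfl), hstar0 p' (Or.inr rfl), add_zero, add_zero] at h0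
  -- the square through `q` is constant and meets `A`
  set t := xor (xor (q (I.vars e 0)) (q (I.vars e 1))) (y e) with ht
  have hcorner : InSlice I y K w₁ (Function.update (Function.update q p t) p' t) := by
    refine (inSlice_iff he).2 ⟨inSliceBut_update hpK hpC₁ hpG₁ (inSliceBut_update hpK hpC₁ hpG₁ hq (Or.inl rfl) t) (Or.inr rfl) t, ?_⟩
    rw [eval_square hI hslots hpe, Bool.and_self, ht]
    cases q (I.vars e 0) <;> cases q (I.vars e 1) <;> cases y e <;> rfl
  have hκ := hT3' _ hcorner
  have hsq := bit_gval_square hI hslots hpp' q t t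
  have hsq' := bit_gval_square hI hslots hpp' q (q p) (q p')
  simp only [h0.1, h0.2, hstar0 p (Or.inl rfl), hstar0 p' (Or.inr rfl), add_zero, mul_zero] at hsq hsq'
  have hqq : Function.update (Function.update q p (q p)) p' (q p') = q := by
    ext w
    by_cases hw' : w = p'
    · subst hw'; simp
    · by_cases hw : w = p
      · subst hw; simp [Function.update_of_ne hne]
      · rw [Function.update_of_ne hw', Function.update_of_ne hw]
  rw [hqq] at hsq'
  rw [← bit_injective (hsq'.trans hsq.symm)] at hκ
  exact hκ hq₂

end Main

end Summit.PneNP.PneNP.Theorems.PstarDirtyMemberSquare
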